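import Literature.AlgebraicGeometry.Resolution.AffinePointBlowupCharts
import Literature.AlgebraicGeometry.Resolution.PlanePointBlowupLocal
import Literature.AlgebraicGeometry.Resolution.BlowupsLocal
import Literature.AlgebraicGeometry.Resolution.BlowupsEquivariant
import Literature.AlgebraicGeometry.Resolution.NormalCrossingsLocal
import HarnessLib

/-!
# Blowing up a point that has an AFFINE-SPACE CHART `𝔸ⁿ⁺¹_K`: the blow-up is smooth over `K` — every `n`, every field `K`

Topic: `Literature/AlgebraicGeometry/Resolution`. The every-dimension form of `PlanePointBlowupLocal.lean` (`n = 1`), on top of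
`AffinePointBlowupCharts.lean` (any blowing up of `𝔸ⁿ⁺¹_K` at the origin is covered by `n + 1` affine spaces, hence smooth over
EVERY field). Let `f : Z → Spec K` be smooth and `x₀ ∈ Z` a closed point admitting an AFFINE CHART over `K`
(`HasAffineChart n f x₀`: an open `V ∋ x₀` and an isomorphism `e : V ≅ 𝔸ⁿ⁺¹_K` OVER `K` sending `x₀` to the origin). Then for EVERY
blowing up `π : W → Z` along the reduced ideal `𝓘_{x₀}`:
* `isBlowup_restrict_comp_affineChart` — over the chart, `π` is (up to `e`) a blowing up of `𝔸ⁿ⁺¹_K` at the origin;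
* `smooth_comp_of_hasAffineChart` — **`W → Spec K` is SMOOTH** (over the chart: `AffinePointBlowup.smooth_comp`; off `x₀`: the
  blow-up is an isomorphism, `IsBlowup.isIso_compl`);
* `vanishingIdeal_singleton_ne_bot_of_hasAffineChart`, `irreducibleSpace_of_hasAffineChart`, `isIntegral_of_hasAffineChart`;
* `hasAffineChart_ξ` — the origin of `𝔸ⁿ⁺¹_K` has the tautological chart.
WHY (cell res-hironaka, D-0124 RESCUE bed): the AMBIENT half of the induction step for multi-round point blow-up chains on the
`𝔸³` / `𝔸⁴` bed rows (kangaroo, Narasimhan, cross specimen); the chart-transfer half is `AffinePointBlowupChartTransfer.lean`.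

## References
* The Stacks Project, Tags 0804, 02OS. [cite: StacksProject, Tag 0804]
* U. Görtz, T. Wedhorn, *Algebraic Geometry I* (2nd ed. 2020), Prop. 13.91. [cite: GortzWedhorn2020, Prop. 13.91]
* A. Grothendieck, EGA IV₄ (1967), Prop. 17.5.8 (iii). [Grothendieck1967]
-/

noncomputable section

set_option backward.isDefEq.respectTransparency false

open CategoryTheory AlgebraicGeometry TopologicalSpace Opposite

namespace Literature.AlgebraicGeometry.Resolution

namespace AffinePointBlowup

open Scheme.IdealSheafData

universe u

variable {n : ℕ} {K : Type u} [Field K]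

/-! ## Affine-space charts -/

variable (n) in
/-- **An affine-space chart at `x₀` over `K`**: an open `V ∋ x₀` with an isomorphism `e : V ≅ 𝔸ⁿ⁺¹_K` over `K` sending `x₀` to the
origin. [cite: GortzWedhorn2020, Prop. 13.91] -/
def HasAffineChart {Z : Scheme.{u}} (f : Z ⟶ Spec (.of K)) (x₀ : Z) : Prop :=
  ∃ (V : Z.Opens) (hx₀ : x₀ ∈ V) (e : (V : Scheme.{u}) ≅ P n K),
    e.hom ≫ AffinePointBlowup.f n K = V.ι ≫ f ∧ e.hom.base ⟨x₀, hx₀⟩ = ξ n K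

variable (n K) in
/-- The origin of `𝔸ⁿ⁺¹_K` has the tautological affine chart `V = ⊤`. [cite: StacksProject, Tag 01HR] -/
theorem hasAffineChart_ξ : HasAffineChart n (AffinePointBlowup.f n K) (ξ n K) :=
  ⟨⊤, trivial, (P n K).topIso, by rw [Scheme.topIso_hom], rfl⟩

/-! ## The blow-up over a plane chart -/

section Chart

variable {Z : Scheme.{u}} {f : Z ⟶ Spec (.of K)} {x₀ : Z} {V : Z.Opens} {W : Scheme.{u}} {π : W ⟶ Z}

/-- Moving `𝓘_{ξ}` to the chart: `e_* (𝓘_{x₀}|_V) = 𝓘_{origin}` on `𝔸²_K`. [cite: GortzWedhorn2020, Prop. 13.91] -/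
theorem comap_comap_vanishingIdeal_singleton_eq_𝓘 (hx₀ : IsClosed ({x₀} : Set Z)) (hx₀V : x₀ ∈ V)
    (e : (V : Scheme.{u}) ≅ P n K) (hex₀ : e.hom.base ⟨x₀, hx₀V⟩ = ξ n K) :
    ((vanishingIdeal (⟨{x₀}, hx₀⟩ : Closeds Z)).comap V.ι).comap e.inv = 𝓘 n K := by
  rw [comap_vanishingIdeal_of_isOpenImmersion V.ι]
  have h := vanishingIdeal_comap_hom e.symm ((⟨{x₀}, hx₀⟩ : Closeds Z).preimage V.ι.continuous)
  rw [Iso.symm_hom] at h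
  rw [h, 𝓘, C₀]
  congr 1
  apply Closeds.ext
  simp only [Closeds.coe_preimage, Closeds.coe_mk]
  ext z
  simp only [Set.mem_preimage, Set.mem_singleton_iff, Scheme.Opens.ι_apply]
  constructor
  · intro hz
    have h1 : e.inv.base z = ⟨x₀, hx₀V⟩ := Subtype.ext hz
    have h2 : e.hom.base (e.inv.base z) = z := by
      rw [← Scheme.Hom.comp_apply, Iso.inv_hom_id]
      rfl
    rw [← h2, h1, hex₀]
  · rintro rfl
    have h2 : e.inv.base (e.hom.base ⟨x₀, hx₀V⟩) = ⟨x₀, hx₀V⟩ := by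
      rw [← Scheme.Hom.comp_apply, Iso.hom_inv_id]
      rfl
    rw [← hex₀, h2]

/-- **Over a plane chart the blow-up of `x₀` is a blow-up of `𝔸²_K` at the origin**: `(π|_V) ≫ e` is a blowing up of
`P K` along `𝓘_{origin}`. [cite: GortzWedhorn2020, Prop. 13.91] -/
theorem isBlowup_restrict_comp_affineChart (hx₀ : IsClosed ({x₀} : Set Z)) (hx₀V : x₀ ∈ V)
    (e : (V : Scheme.{u}) ≅ P n K) (hex₀ : e.hom.base ⟨x₀, hx₀V⟩ = ξ n K)
    (hπ : IsBlowup π (vanishingIdeal (⟨{x₀}, hx₀⟩ : Closeds Z))) : IsBlowup ((π ∣_ V) ≫ e.hom) (𝓘 n K) := by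
  have h := (hπ.restrict V).comp_iso e
  rwa [comap_comap_vanishingIdeal_singleton_eq_𝓘 hx₀ hx₀V e hex₀] at h

/-- **The blow-up of a point with a plane chart is SMOOTH over `K`** — every field `K`: over the chart it is the blown-up
affine space (`AffinePointBlowup.smooth_comp`), off the point it is an isomorphism onto an open of the smooth `Z`.
[cite: GortzWedhorn2020, Prop. 13.91] -/
theorem smooth_comp_of_affineChart [Smooth f] (hx₀ : IsClosed ({x₀} : Set Z)) (hx₀V : x₀ ∈ V)
    (e : (V : Scheme.{u}) ≅ P n K) (he : e.hom ≫ AffinePointBlowup.f n K = V.ι ≫ f) (hex₀ : e.hom.base ⟨x₀, hx₀V⟩ = ξ n K)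
    (hπ : IsBlowup π (vanishingIdeal (⟨{x₀}, hx₀⟩ : Closeds Z))) : Smooth (π ≫ f) := by
  let Vc : Z.Opens := ⟨((vanishingIdeal (⟨{x₀}, hx₀⟩ : Closeds Z)).support : Set Z)ᶜ,
    (vanishingIdeal (⟨{x₀}, hx₀⟩ : Closeds Z)).support.isClosed.isOpen_compl⟩
  refine IsZariskiLocalAtSource.of_iSup_eq_top (P := @Smooth) (fun b : Bool => bif b then π ⁻¹ᵁ V else π ⁻¹ᵁ Vc)
    ?_ fun b => ?_
  · rw [← PlanePointBlowup.preimage_sup_preimage_compl_eq_top hx₀ hx₀V (π := π)]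
    apply le_antisymm
    · refine iSup_le fun b => ?_
      cases b
      · exact le_sup_right
      · exact le_sup_left
    · exact sup_le (le_iSup (fun b : Bool => bif b then π ⁻¹ᵁ V else π ⁻¹ᵁ Vc) true)
        (le_iSup (fun b : Bool => bif b then π ⁻¹ᵁ V else π ⁻¹ᵁ Vc) false)
  · cases b with
    | true =>
      -- over the chart: the blown-up plane
      show Smooth ((π ⁻¹ᵁ V).ι ≫ π ≫ f)
      have hb := isBlowup_restrict_comp_affineChart hx₀ hx₀V e hex₀ hπ
      haveI := smooth_comp hb
      have heq : (π ⁻¹ᵁ V).ι ≫ π ≫ f = ((π ∣_ V) ≫ e.hom) ≫ AffinePointBlowup.f n K := by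
        rw [Category.assoc, he, ← Category.assoc, ← morphismRestrict_ι, Category.assoc]
      rw [heq]
      infer_instance
    | false =>
      -- off the point: an isomorphism onto an open of `Z`
      show Smooth ((π ⁻¹ᵁ Vc).ι ≫ π ≫ f)
      haveI : IsIso (π ∣_ Vc) := hπ.isIso_compl
      have heq : (π ⁻¹ᵁ Vc).ι ≫ π ≫ f = (π ∣_ Vc) ≫ Vc.ι ≫ f := by
        rw [← Category.assoc, ← morphismRestrict_ι, Category.assoc]
      rw [heq]
      infer_instance

/-- **`𝓘_{x₀} ≠ 0` at a point with a plane chart.** [cite: StacksProject, Tag 01HR] -/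
theorem vanishingIdeal_singleton_ne_bot_of_affineChart (hx₀ : IsClosed ({x₀} : Set Z)) (hx₀V : x₀ ∈ V)
    (e : (V : Scheme.{u}) ≅ P n K) (hex₀ : e.hom.base ⟨x₀, hx₀V⟩ = ξ n K) :
    vanishingIdeal (⟨{x₀}, hx₀⟩ : Closeds Z) ≠ ⊥ := by
  intro h
  have h2 := comap_comap_vanishingIdeal_singleton_eq_𝓘 hx₀ hx₀V e hex₀
  rw [h, Scheme.IdealSheafData.comap_bot, Scheme.IdealSheafData.comap_bot] at h2
  exact 𝓘_ne_bot n K h2.symm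

end Chart

/-! ## Packaged over `HasAffineChart` -/

section Packaged

variable {Z : Scheme.{u}} {f : Z ⟶ Spec (.of K)} {x₀ : Z} {W : Scheme.{u}} {π : W ⟶ Z}

/-- **The blow-up of a point with a plane chart is SMOOTH over `K`** (every field `K`). [cite: GortzWedhorn2020, Prop. 13.91] -/
theorem smooth_comp_of_hasAffineChart [Smooth f] (hx₀ : IsClosed ({x₀} : Set Z)) (hc : HasAffineChart n f x₀)
    (hπ : IsBlowup π (vanishingIdeal (⟨{x₀}, hx₀⟩ : Closeds Z))) : Smooth (π ≫ f) := by
  obtain ⟨V, hx₀V, e, he, hex₀⟩ := hc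
  exact smooth_comp_of_affineChart hx₀ hx₀V e he hex₀ hπ

/-- `𝓘_{x₀} ≠ 0` at a point with a plane chart. [cite: StacksProject, Tag 01HR] -/
theorem vanishingIdeal_singleton_ne_bot_of_hasAffineChart (hx₀ : IsClosed ({x₀} : Set Z)) (hc : HasAffineChart n f x₀) :
    vanishingIdeal (⟨{x₀}, hx₀⟩ : Closeds Z) ≠ ⊥ := by
  obtain ⟨V, hx₀V, e, -, hex₀⟩ := hc
  exact vanishingIdeal_singleton_ne_bot_of_affineChart hx₀ hx₀V e hex₀

/-- The blow-up of an integral scheme at a point with a plane chart is irreducible. [cite: StacksProject, Tag 02ND] -/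
theorem irreducibleSpace_of_hasAffineChart [IsIntegral Z] (hx₀ : IsClosed ({x₀} : Set Z)) (hc : HasAffineChart n f x₀)
    (hπ : IsBlowup π (vanishingIdeal (⟨{x₀}, hx₀⟩ : Closeds Z))) : IrreducibleSpace W :=
  hπ.irreducibleSpace (vanishingIdeal_singleton_ne_bot_of_hasAffineChart hx₀ hc)

/-- The blow-up of an integral scheme at a point with a plane chart is integral. [cite: StacksProject, Tag 02ND] -/
theorem isIntegral_of_hasAffineChart [IsIntegral Z] (hx₀ : IsClosed ({x₀} : Set Z)) (hc : HasAffineChart n f x₀)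
    (hπ : IsBlowup π (vanishingIdeal (⟨{x₀}, hx₀⟩ : Closeds Z))) : IsIntegral W :=
  hπ.isIntegral (vanishingIdeal_singleton_ne_bot_of_hasAffineChart hx₀ hc)

end Packaged

end AffinePointBlowup

end Literature.AlgebraicGeometry.Resolution

end
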